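import Summits.QuantumFields.BalabanUV.T4Continuum.Spine.NE1p.DressedSmallFieldRecordLabelsKillConvention
import Summits.QuantumFields.BalabanUV.T4Continuum.Spine.NE1p.DressedSmallFieldOnCoresSlotLetters

/-!
# T⁴ programme, spine estimate NE1′ (node O3b/H2) — THE KILL CONVENTION AT THE SUBSTRATE'S GAUSSIAN LETTERS OF RECORD AND AT THE
# ACTIVITY SLOT OF RECORD: W91 §3's two ENDs at `ℓ₀ := coreLettersOf A` on a driven two-run object, N1a's three operator-letter blocks
# `hm` ∕ `hN` ∕ `hq` DISCHARGED per factor into the substrate's scalar letter conditions BY NAME (S30 §1), NO `hkill`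

Cell `pub-balaban`, sub-cell `t4`, BINDER-OWNERS row NE1′ (owner lineage t4-ne1p-p1); NE1′ formalisation crew, unit
b2b-balaban-t4-ne1p-formalise-leaf-05, generation 13; crew row S65 ∕ DAG N29zzzzzj of `t4/formal/NE1p/LEAVES.md`, PART 1 of 2 (INTENT
`CLAIMS.log` l.24556; BOOKED typer R-T152 l.24603; X240).  ADDITIVE — imports this lineage's W91
`Spine/NE1p/DressedSmallFieldRecordLabelsKillConvention` (p243583; ⇒ owner N1a P3∕P2∕P1, substrate (A) `SubstrateNestedToriOfRecord`,
(B) `SubstrateSlotActZero`, W-23c `SubstrateBondsOfCubes`) and crew S30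
`Spine/NE1p/DressedSmallFieldOnCoresSlotLetters` (p228879, leaf-01; ⇒ the substrate's `SubstrateSlotsOfRecord` ∕ `SubstrateGaussianLettersBall`)
ONLY; THEOREMS ONLY (0 `def`, 0 `def … : Prop`, 0 cite, 0 sorry); nothing of W91 ∕ N1a ∕ N0y ∕ S30 ∕ the substrate restated — used BY NAME.

WHY THIS FILE.  After the owner's N1a (N0y's ENDs AT THE CARRIERS OF RECORD, row NE5's label type `InnerLabel R.carriers.Dom (Bnd R)`) and
this lineage's W91 (the displayed `hkill` DISCHARGED by the convention `killConv`, for ANY letter family `ℓ₀`), the skeleton's residue at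
NE5's index reads «FILTER + `hAmp` + operator conditions + class radii» (v1.8.4 §7 gloss).  The OPERATOR CONDITIONS are W91 §3's three
displayed blocks on `ℓ₀`'s Gaussian letters — for every level `k`, window point `g ∈ W`, background `U`, carrier `X` and factor `p = (X′, j)`:
`hm` (`0 < mq`), `hN` (a.e.-strong measurability of `N o` in the contour parameter, holomorphy of `o ↦ N o a` on the class ball, `‖N o a‖ ≤ N₀`),
`hq` (joint measurability, holomorphy, margin `mq‖v‖² − bq ≤ Re q o a v`) = rows NE2∕NE3's Gaussian data as row NE5 carries them.  At the
substrate's CORE LETTERS OF RECORD `coreLettersOf A` (`N := gaussN (linForm base rd)`, `q := gaussQ (linForm base rd) coords`) those blocks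
ARE crew S30 §1's kernel lemmas `margin_pos` ∕ `hN_coreLettersOf` ∕ `hq_coreLettersOf` over p3's PROVED finite-dimensional Gaussian lemmas.
THIS ROW (two parts) does that wiring for N1a's chain, nothing else (the S30 ∕ S31 ∕ S63-§2 pattern):
* §1 **`attachedPart_locE_le_of_coreLettersOf_recordLabels`** ∕ **`muPart_locE_le_of_coreLettersOf_recordLabels`** — W91 §3's
  `attachedPart_∕muPart_locE_le_of_actOfLetters_recordLabels_any` ONCE BY NAME each at `R := D.toTwoRuns`,
  `ℓ₀ := coreLettersOf D P Op 𝒵 dom Jc V mI A` for ANY factor letters `A : ∀ X j, ActLetters D P Op 𝒵 dom Jc V mI X j` over NE5's label type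
  on ANY driven two-run object `D : DrivenRuns G` and standing scale `hk : k + 1 + m′ ≤ m + K`, with the letters SPECIALISED to
  `N₀ k p X := gaussC (mI p.1 p.2)·√(max 1 (card!·β₀ p^{card} + d₀ p))`, `mq k p X := (γ p − card (mI p.1 p.2)·ϑ p·R′ k)∕2`, `bq := 0` and the
  three blocks SUPPLIED by S30 §1.  DISPLAYED INSTEAD (the substrate's S-U3 currency, finitely many SCALARS per factor): measurability of
  the tables `base` ∕ `rd` in the contour parameter (`hbase` ∕ `hrdm`); `0 ≤ β₀`, `0 < d₀`, `0 ≤ R′ k`; the read-out bound `hrd`; the CENTRE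
  CONDITIONS `hctr` at every class centre (entries `≤ β₀`, determinant real with real part `≥ d₀`, `γ`-coercivity); the two ARITHMETIC radius
  smallnesses `hbud` ∕ `hmq`.  Every other binder VERBATIM W91's (`hroom`, `hO` ∕ `hH`, the located clauses, (B3-form) `hAmp` — now on
  the EXPLICIT letters —, N0m's `hϱ` ∕ `hϱA` resp. road P1's `h0` ∕ `h01` ∕ `hμ`); NO `hkill`; conclusions LITERALLY W91's at
  `ℓ₀ := coreLettersOf … A`.  CENSUS vs W91 §3 (binders, by name): MINUS = [`mq`, `bq`, `N₀` (specialised), `hm` (proved), `hN`, `hq`];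
  PLUS = [`β₀`, `ϑ`, `d₀`, `γ` (letters per factor), `hR′`, `hbase`, `hrdm`, `hβ₀`, `hd₀`, `hrd`, `hctr`, `hbud`, `hmq`]; rest IDENTICAL.
* §2 = PART 2 (`Spine/NE1p/DressedSmallFieldRecordLabelsKillSlotsOfRecord`, imports this file ONLY)
  **`attachedPart_locE_le_slotsOfRecord_act_recordLabels`** ∕ **`muPart_locE_le_slotsOfRecord_act_recordLabels`** — §1 at
  `Op := OpDatum (SpeciesRec D n T ι′ Ω 𝒴)`, `A := L.A` for slot letters `L : SlotLetters …`, the activities written LITERALLY as the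
  (2.14) ACTIVITY SLOT OF RECORD `(slotsOfRecord D ι c a σ P 𝒵 dom Jc V mI L).act (domEmb _ (k+1) Z) (InnerLabel.ofTorus hk ℓ) op h` of
  MAP §O1 O-8 (`slotsOfRecord_act`, `rfl`) SUMMED OVER THE LABELS OF RECORD (the owner's filter) — S30 §3's reading for N1a's chain.
  The class centre `ctr` stays GENERAL (its identification with run B's operator datum of record is the substrate's ∕ owner's READING).

WHAT THIS DOES TO THE RESIDUE (wording offered to the owner ∕ typer; nothing re-labelled here).  For the activity slot of record at row
NE5's label type, after N1a + W91 + this row: «operator conditions» = finitely many SCALAR per-factor conditions on the substrate's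
displayed tables at the class centres (KERNEL from there down, by S30 §1 over p3); `hkill` GONE (W91); residue = the FILTER (by fiat,
W91's `killConv`) + (B3-form) `hAmp` (READING, UNPRINTED for Bałaban's cores — G-ne9p2-5) + the class radii `hO` ∕ `hH` ∕ `hroom` +
those scalar centre conditions, whose satisfaction BY THE DATUM OF RECORD (which tables realise Bałaban's `C^{(k)}(Z₀,σ)`, `Γ_k` of
[Balaban1988RGII] (2.14) p. 15) is the SUBSTRATE's displayed identification — NOT claimed.  (B1b) stays RELOCATED exactly as W91
words it (the FILTERED sum IS Bałaban's resummed (2.14) small-field expansion at `Z` — NE5's ∕ the substrate's to supply), NOT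
discharged; 0 binders instantiated on Bałaban's densities; no numeral of print asserted (pv22's located `K₀(64,8)` ∕ `64·log 162` ride
inside W91's conclusions); no wall item; wall v1.8 (T4-DAG v48–v54 — words, not kind) does NOT move; R-t4r2-Q2 NOT met thereby;
NE1′ ⇐ the named binders — NOT printed, NOT proved; spine PROVED 0∕9; count 9 unchanged.

HONEST FRAMING.  By-name discharge of displayed binder SHAPES into the substrate's displayed scalar letter conditions over p3's PROVED
finite-dimensional lemmas + one `rfl` reading ([folklore] kernel theorems only); 0 estimates of print; printed loci are TYPE ∕ CONTEXT
through the imported modules, re-asserted nowhere; ABSOLUTE RULE honoured.  Rung (B)+1 on ONE finite four-torus — NOT infinite volume,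
NOT a mass gap, NOT OS on ℝ⁴, NOT Clay.  HONEST DEPENDENCY: continuum YM on T⁴ ⇐ BetaPertH ∧ nine spine estimates (0/9 proved);
BetaPertH ⇐ (D1) ∧ (D4) ∧ CAP+tail; G-an2-4 gates asym, D1 and NE2/3/4. -/

noncomputable section

namespace Summit.QuantumFields.BalabanUV.T4Continuum.NE1p.DressedSmallFieldRecordLabelsKillSlotLetters

open scoped BigOperators Matrix
open Metric Set MeasureTheory
open Literature.MathematicalPhysics.QuantumFieldTheory.Balaban1983to89 (GaugeGroup)
open Literature.MathematicalPhysics.QuantumFieldTheory.Balaban1983to89.B13Resummation (locE)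
open Literature.MathematicalPhysics.QuantumFieldTheory.Balaban1983to89.B5Prop11Lower (nsq)
open Literature.MathematicalPhysics.QuantumFieldTheory.Balaban1983to89.TreeLengthTorus (TDom tsys torusTreeLen)
open Literature.MathematicalPhysics.QuantumFieldTheory.Balaban1983to89.TreeLengthTorusGeometry (tgeometry)
open Literature.MathematicalPhysics.QuantumFieldTheory.Balaban1983to89.B12TreeDecay (K₀)
open Summit.QuantumFields.BalabanUV.T4Continuum.B13OpDatum (OpDatum)
open Summit.QuantumFields.BalabanUV.T4Continuum.B13HistMeasurable (MeasPotFrame B13HistM)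
open Summit.QuantumFields.BalabanUV.T4Continuum.B13StepTermLabels (InnerLabel)
open Summit.QuantumFields.BalabanUV.T4Continuum.B13InnerData (Bnd)
open Summit.QuantumFields.BalabanUV.T4Continuum.B13DomainGeometryTR (domEmb)
open Summit.QuantumFields.BalabanUV.T4Continuum.SubstrateTwoRunsDriven (DrivenRuns)
open Summit.QuantumFields.BalabanUV.T4Continuum.SubstrateActivities (coreOf actOfLetters)
open Summit.QuantumFields.BalabanUV.T4Continuum.SubstrateGaussianLetters (gaussC linForm)
open Summit.QuantumFields.BalabanUV.T4Continuum.SubstrateGaussianLettersBall (detBudget)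
open Summit.QuantumFields.BalabanUV.T4Continuum.SubstrateSlotsOfRecord (ActLetters coreLettersOf SpeciesRec SlotLetters slotsOfRecord
  slotsOfRecord_act)
open Summit.QuantumFields.BalabanUV.T4Continuum.SubstrateNestedToriOfRecord (InnerLabel.ofTorus torusLabels)
open Summit.QuantumFields.BalabanUV.T4Continuum.SubstrateBondsOfCubes (bondsOfFineCubes)
open Summit.QuantumFields.BalabanUV.T4Continuum.TorusBlockRefinement (trefineDom)
open Summit.QuantumFields.BalabanUV.T4Continuum.NE1p.DressedSmallFieldOnCoresSlotLetters (margin_pos hN_coreLettersOf hq_coreLettersOf)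
open Summit.QuantumFields.BalabanUV.T4Continuum.NE1p.DressedSmallFieldRecordLabelsKillConvention
  (attachedPart_locE_le_of_actOfLetters_recordLabels_any muPart_locE_le_of_actOfLetters_recordLabels_any)

variable {G : Type} [GaugeGroup G] (D : DrivenRuns G) {k : ℕ} (hk : k + 1 + D.m' ≤ D.F.m + D.K) (P : MeasPotFrame D.carriers)

/-! ## §1 W91 §3's two ENDs at the core letters of record `coreLettersOf A`, operator letters DISCHARGED (S30 §1 by name) -/

section CoreLettersOf

variable (Op : Type) [NormedAddCommGroup Op] [NormedSpace ℂ Op]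
  (𝒵 : D.carriers.Dom → InnerLabel D.carriers.Dom (Bnd D.toTwoRuns) → Type) [∀ X j, Fintype (𝒵 X j)]
  (dom : ∀ X j, 𝒵 X j → D.carriers.Dom)
  (Jc : D.carriers.Dom → InnerLabel D.carriers.Dom (Bnd D.toTwoRuns) → Type) [∀ X j, Fintype (Jc X j)]
  (V : D.carriers.Dom → InnerLabel D.carriers.Dom (Bnd D.toTwoRuns) → Type) [∀ X j, NormedAddCommGroup (V X j)]
  [∀ X j, InnerProductSpace ℝ (V X j)] [∀ X j, MeasurableSpace (V X j)] [∀ X j, BorelSpace (V X j)] [∀ X j, FiniteDimensional ℝ (V X j)]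
  (mI : D.carriers.Dom → InnerLabel D.carriers.Dom (Bnd D.toTwoRuns) → Type) [∀ X j, Fintype (mI X j)] [∀ X j, DecidableEq (mI X j)]

open Classical in
/-- **THE ATTACHED PART OF THE ACTIVITY OF RECORD AT THE CORE LETTERS OF RECORD, SUMMED OVER THE LABELS OF RECORD, OPERATOR LETTERS
DISCHARGED** (kernel; W91 §3 `attachedPart_locE_le_of_actOfLetters_recordLabels_any` ONCE BY NAME at `R := D.toTwoRuns`,
`ℓ₀ := coreLettersOf D P Op 𝒵 dom Jc V mI A`, letters `N₀ k p X := gaussC (mI p.1 p.2)·√(max 1 (card!·β₀ p^{card} + d₀ p))`,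
`mq k p X := (γ p − card·ϑ p·R′ k)∕2`, `bq := 0`, blocks `hm` ∕ `hN` ∕ `hq` from S30 §1 `margin_pos` ∕ `hN_coreLettersOf` ∕ `hq_coreLettersOf`).
Binders, all DISPLAYED: `hroom`, `hR′`; per factor the substrate's primitive letter conditions `hbase` ∕ `hrdm` ∕ `hβ₀` ∕ `hd₀` ∕ `hrd`, the
CENTRE CONDITIONS `hctr` at every class centre, the radius smallnesses `hbud` ∕ `hmq`; then W91's VERBATIM (`hO` ∕ `hH` at level `k+1`, the
located clauses, (B3-form) `hAmp` on the filtered labels of record — on the explicit letters —, `hϱ` ∕ `hϱA`).  NO `hkill`.  Conclusion LITERALLY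
W91's: `‖E[Z ↦ Σ_{ℓ ∈ (torusLabels hk Z).filter F} actOfLetters (coreLettersOf A) (domEmb _ (k+1) Z) (ofTorus ℓ) o (h₀ + w)](X₀) − E[… o h₀](X₀)‖
≤ 4·(e·9·64·K₀(64,8)²)·A₁·e^{−r₁·dj X₀}`.  Nothing of the substrate's data is asserted. [folklore] -/
theorem attachedPart_locE_le_of_coreLettersOf_recordLabels {W : Set (ℕ → ℝ)}
    {ctr : ℕ → (ℕ → ℝ) → D.carriers.BgB → Op × B13HistM P} {ROp RHist R' : ℕ → ℝ}
    (A : ∀ X j, ActLetters D P Op 𝒵 dom Jc V mI X j)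
    {β₀ ϑ d₀ γ : D.carriers.Dom → InnerLabel D.carriers.Dom (Bnd D.toTwoRuns) → ℝ}
    (hroom : ∀ k, ROp k < R' k) (hR' : ∀ k, 0 ≤ R' k)
    -- the substrate's PRIMITIVE per-factor letter conditions (S-U3 currency) replacing W91's `hm` ∕ `hN` ∕ `hq`
    (hbase : ∀ X j ii jj, Measurable fun a => (A X j).base a ii jj)
    (hrdm : ∀ X j ii jj (o' : Op), Measurable fun a => (A X j).rd a ii jj o')
    (hβ₀ : ∀ X j, 0 ≤ β₀ X j) (hd₀ : ∀ X j, 0 < d₀ X j)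
    (hrd : ∀ X j a ii jj, ‖(A X j).rd a ii jj‖ ≤ ϑ X j)
    -- the CENTRE CONDITIONS at every class centre: entry bound, real determinant with real part `≥ d₀`, `γ`-coercivity
    (hctr : ∀ k, ∀ g ∈ W, ∀ (U : D.carriers.BgB) (X : D.carriers.Dom) (j : InnerLabel D.carriers.Dom (Bnd D.toTwoRuns))
      (a : (Jc X j ⊕ 𝒵 X j) → ℝ × ℝ),
      (∀ ii jj, ‖linForm (A X j).base (A X j).rd (ctr k g U).1 a ii jj‖ ≤ β₀ X j) ∧
      ((linForm (A X j).base (A X j).rd (ctr k g U).1 a).det).im = 0 ∧ d₀ X j ≤ ((linForm (A X j).base (A X j).rd (ctr k g U).1 a).det).re ∧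
      (∀ x : mI X j → ℂ, γ X j * nsq x ≤ (star x ⬝ᵥ (linForm (A X j).base (A X j).rd (ctr k g U).1 a *ᵥ x)).re))
    -- the two ARITHMETIC smallnesses of the operator radius, per level and factor
    (hbud : ∀ k X j, detBudget (Fintype.card (mI X j)) (β₀ X j) (ϑ X j) (R' k) < d₀ X j)
    (hmq : ∀ k X j, Fintype.card (mI X j) * ϑ X j * R' k < γ X j)
    {g : ℕ → ℝ} (hg : g ∈ W) {U : D.carriers.BgB} {o : Op} {h₀ w : B13HistM P} {ϱ : ℝ}
    (hO : ‖o - (ctr (k + 1) g U).1‖ ≤ ROp (k + 1)) (hH : ‖h₀ - (ctr (k + 1) g U).2‖ + ϱ * ‖w‖ ≤ RHist (k + 1))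
    {A₀ A₁ Rkp r₁ : ℝ} (X₀ : (tsys 4 (D.cubesPerDir (k + 1))).Dom) (hA₀ : 0 ≤ A₀) (hA₁ : 0 ≤ A₁) (hr₁ : 0 ≤ r₁)
    (hrate : r₁ + 2 * (64 * Real.log 162) + 2 ≤ Rkp)
    (hsmall : (A₀ + ϱ * A₁) * Real.exp (5 * r₁ + 1) * K₀ 64 8 * 9 * 64 ≤ 1)
    {δ κ α₆ Rc s t : ℝ} (hα₆ : 0 ≤ α₆)
    (hκ : 64 * Real.log 162 + 1 ≤ δ * κ) (h229 : Real.exp 1 * K₀ 64 8 * 64 * α₆ ≤ 1)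
    (hs0 : 0 ≤ s) (hs1 : s ≤ 1) (ht : 0 ≤ t)
    (hRR : Rkp ≤ Rc - 64 * (Real.exp (Rc * 5) * s * Real.exp ((4 * (D.F.L : ℝ) ^ (4 * D.m')) * t)))
    -- (B3-form) on the filtered labels of record, on the EXPLICIT letters
    (hAmp : ∀ Z : (tsys 4 (D.cubesPerDir (k + 1))).Dom, Z.1 ⊆ X₀.1 → ∀ ℓ ∈ (torusLabels hk Z).filter fun ℓ =>
        ℓ.Z₀ = trefineDom D.F.L (D.cubesPerDir (k + 1)) Z ∧
          ℓ.P ⊆ bondsOfFineCubes hk (ℓ.Z₀.1 \ ℓ.fam.biUnion fun Y : (tsys 4 (D.F.L * D.cubesPerDir (k + 1))).Dom => Y.1) ∧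
          (ℓ.Z₀.1 \ ℓ.fam.biUnion fun Y : (tsys 4 (D.F.L * D.cubesPerDir (k + 1))).Dom => Y.1).card ≤ 2 * ℓ.P.card,
      (coreOf P Op 𝒵 dom Jc V (coreLettersOf D P Op 𝒵 dom Jc V mI A) (domEmb D.toTwoRuns (k + 1) Z) (InnerLabel.ofTorus hk ℓ)).lam.real univ *
          ((coreOf P Op 𝒵 dom Jc V (coreLettersOf D P Op 𝒵 dom Jc V mI A) (domEmb D.toTwoRuns (k + 1) Z) (InnerLabel.ofTorus hk ℓ)).wB *
              (gaussC (mI (domEmb D.toTwoRuns (k + 1) Z) (InnerLabel.ofTorus hk ℓ)) *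
                Real.sqrt (max 1 ((Fintype.card (mI (domEmb D.toTwoRuns (k + 1) Z) (InnerLabel.ofTorus hk ℓ))).factorial *
                  β₀ (domEmb D.toTwoRuns (k + 1) Z) (InnerLabel.ofTorus hk ℓ) ^
                    Fintype.card (mI (domEmb D.toTwoRuns (k + 1) Z) (InnerLabel.ofTorus hk ℓ)) +
                  d₀ (domEmb D.toTwoRuns (k + 1) Z) (InnerLabel.ofTorus hk ℓ)))) * Real.exp 0) *
          (Real.pi / ((γ (domEmb D.toTwoRuns (k + 1) Z) (InnerLabel.ofTorus hk ℓ) -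
              Fintype.card (mI (domEmb D.toTwoRuns (k + 1) Z) (InnerLabel.ofTorus hk ℓ)) *
                ϑ (domEmb D.toTwoRuns (k + 1) Z) (InnerLabel.ofTorus hk ℓ) * R' (k + 1)) / 2 / 2)) ^
            (Module.finrank ℝ (V (domEmb D.toTwoRuns (k + 1) Z) (InnerLabel.ofTorus hk ℓ)) / 2 : ℝ) *
        Real.exp ((coreOf P Op 𝒵 dom Jc V (coreLettersOf D P Op 𝒵 dom Jc V mI A) (domEmb D.toTwoRuns (k + 1) Z)
          (InnerLabel.ofTorus hk ℓ)).N₁ * (‖h₀‖ + ϱ * ‖w‖)) ≤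
      (A₀ + ϱ * A₁) * ((∏ Y ∈ ℓ.fam, (α₆ * Real.exp (-(δ * κ * torusTreeLen Y.1)) *
        Real.exp (-(Rc * (torusTreeLen Y.1 + 5))))) * (s ^ 2 * t) ^ ℓ.P.card))
    (hϱ : 2 ≤ ϱ) (hϱA : A₀ ≤ ϱ * A₁) :
    ‖locE (tgeometry 4 (D.cubesPerDir (k + 1))).ι (tgeometry 4 (D.cubesPerDir (k + 1))).cubes
          (fun Z => ∑ ℓ ∈ (torusLabels hk Z).filter fun ℓ =>
              ℓ.Z₀ = trefineDom D.F.L (D.cubesPerDir (k + 1)) Z ∧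
                ℓ.P ⊆ bondsOfFineCubes hk (ℓ.Z₀.1 \ ℓ.fam.biUnion fun Y : (tsys 4 (D.F.L * D.cubesPerDir (k + 1))).Dom => Y.1) ∧
                (ℓ.Z₀.1 \ ℓ.fam.biUnion fun Y : (tsys 4 (D.F.L * D.cubesPerDir (k + 1))).Dom => Y.1).card ≤ 2 * ℓ.P.card,
            actOfLetters P Op 𝒵 dom Jc V (coreLettersOf D P Op 𝒵 dom Jc V mI A) (domEmb D.toTwoRuns (k + 1) Z)
              (InnerLabel.ofTorus hk ℓ) o (h₀ + w))
            ((tgeometry 4 (D.cubesPerDir (k + 1))).cubes X₀) -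
        locE (tgeometry 4 (D.cubesPerDir (k + 1))).ι (tgeometry 4 (D.cubesPerDir (k + 1))).cubes
          (fun Z => ∑ ℓ ∈ (torusLabels hk Z).filter fun ℓ =>
              ℓ.Z₀ = trefineDom D.F.L (D.cubesPerDir (k + 1)) Z ∧
                ℓ.P ⊆ bondsOfFineCubes hk (ℓ.Z₀.1 \ ℓ.fam.biUnion fun Y : (tsys 4 (D.F.L * D.cubesPerDir (k + 1))).Dom => Y.1) ∧
                (ℓ.Z₀.1 \ ℓ.fam.biUnion fun Y : (tsys 4 (D.F.L * D.cubesPerDir (k + 1))).Dom => Y.1).card ≤ 2 * ℓ.P.card,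
            actOfLetters P Op 𝒵 dom Jc V (coreLettersOf D P Op 𝒵 dom Jc V mI A) (domEmb D.toTwoRuns (k + 1) Z)
              (InnerLabel.ofTorus hk ℓ) o h₀)
            ((tgeometry 4 (D.cubesPerDir (k + 1))).cubes X₀)‖ ≤
      4 * (Real.exp 1 * 9 * 64 * K₀ 64 8 ^ 2) * A₁ * Real.exp (-(r₁ * (tsys 4 (D.cubesPerDir (k + 1))).dj X₀)) :=
  attachedPart_locE_le_of_actOfLetters_recordLabels_any hk P Op 𝒵 dom Jc V (coreLettersOf D P Op 𝒵 dom Jc V mI A)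
    (mq := fun k p _ => (γ p.1 p.2 - Fintype.card (mI p.1 p.2) * ϑ p.1 p.2 * R' k) / 2) (bq := fun _ _ _ => 0)
    (N₀ := fun _ p _ => gaussC (mI p.1 p.2) *
      Real.sqrt (max 1 ((Fintype.card (mI p.1 p.2)).factorial * β₀ p.1 p.2 ^ Fintype.card (mI p.1 p.2) + d₀ p.1 p.2)))
    hroom (margin_pos D mI hmq) (hN_coreLettersOf D P Op 𝒵 dom Jc V mI A hR' hbase hrdm hβ₀ hd₀ hrd hctr hbud)
    (hq_coreLettersOf D P Op 𝒵 dom Jc V mI A hbase hrdm hrd hctr) hg hO hH X₀ hA₀ hA₁ hr₁ hrate hsmall hα₆ hκ h229 hs0 hs1 ht hRR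
    hAmp hϱ hϱA

open Classical in
/-- **THE μ-PART (ROAD P1's SOURCE PENCIL) OF THE SAME, OPERATOR LETTERS DISCHARGED** (kernel; W91 §3
`muPart_locE_le_of_actOfLetters_recordLabels_any` ONCE BY NAME at `R := D.toTwoRuns`, `ℓ₀ := coreLettersOf … A`, letters and blocks as above):
source pencil `h₀ + sμ • v`, `0 < μ₀ < μ₁`, `‖sμ‖ ≤ μ₀`, (B3-form) `hAmp` at the constant `A′` and class radius `hH` at `μ₁`; conclusion LITERALLY
W91's `≤ e·9·64·K₀(64,8)²·A′·e^{−r₁·dj X₀}·μ₀∕(μ₁ − μ₀)`. [folklore] -/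
theorem muPart_locE_le_of_coreLettersOf_recordLabels {W : Set (ℕ → ℝ)}
    {ctr : ℕ → (ℕ → ℝ) → D.carriers.BgB → Op × B13HistM P} {ROp RHist R' : ℕ → ℝ}
    (A : ∀ X j, ActLetters D P Op 𝒵 dom Jc V mI X j)
    {β₀ ϑ d₀ γ : D.carriers.Dom → InnerLabel D.carriers.Dom (Bnd D.toTwoRuns) → ℝ}
    (hroom : ∀ k, ROp k < R' k) (hR' : ∀ k, 0 ≤ R' k)
    (hbase : ∀ X j ii jj, Measurable fun a => (A X j).base a ii jj)
    (hrdm : ∀ X j ii jj (o' : Op), Measurable fun a => (A X j).rd a ii jj o')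
    (hβ₀ : ∀ X j, 0 ≤ β₀ X j) (hd₀ : ∀ X j, 0 < d₀ X j)
    (hrd : ∀ X j a ii jj, ‖(A X j).rd a ii jj‖ ≤ ϑ X j)
    (hctr : ∀ k, ∀ g ∈ W, ∀ (U : D.carriers.BgB) (X : D.carriers.Dom) (j : InnerLabel D.carriers.Dom (Bnd D.toTwoRuns))
      (a : (Jc X j ⊕ 𝒵 X j) → ℝ × ℝ),
      (∀ ii jj, ‖linForm (A X j).base (A X j).rd (ctr k g U).1 a ii jj‖ ≤ β₀ X j) ∧
      ((linForm (A X j).base (A X j).rd (ctr k g U).1 a).det).im = 0 ∧ d₀ X j ≤ ((linForm (A X j).base (A X j).rd (ctr k g U).1 a).det).re ∧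
      (∀ x : mI X j → ℂ, γ X j * nsq x ≤ (star x ⬝ᵥ (linForm (A X j).base (A X j).rd (ctr k g U).1 a *ᵥ x)).re))
    (hbud : ∀ k X j, detBudget (Fintype.card (mI X j)) (β₀ X j) (ϑ X j) (R' k) < d₀ X j)
    (hmq : ∀ k X j, Fintype.card (mI X j) * ϑ X j * R' k < γ X j)
    {g : ℕ → ℝ} (hg : g ∈ W) {U : D.carriers.BgB} {o : Op} {h₀ v : B13HistM P} {μ₁ : ℝ}
    (hO : ‖o - (ctr (k + 1) g U).1‖ ≤ ROp (k + 1)) (hH : ‖h₀ - (ctr (k + 1) g U).2‖ + μ₁ * ‖v‖ ≤ RHist (k + 1))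
    {A' Rkp r₁ μ₀ : ℝ} (X₀ : (tsys 4 (D.cubesPerDir (k + 1))).Dom) {sμ : ℂ} (hA : 0 ≤ A') (hr₁ : 0 ≤ r₁)
    (hrate : r₁ + 2 * (64 * Real.log 162) + 2 ≤ Rkp)
    (hsmall : A' * Real.exp (5 * r₁ + 1) * K₀ 64 8 * 9 * 64 ≤ 1)
    {δ κ α₆ Rc s t : ℝ} (hα₆ : 0 ≤ α₆)
    (hκ : 64 * Real.log 162 + 1 ≤ δ * κ) (h229 : Real.exp 1 * K₀ 64 8 * 64 * α₆ ≤ 1)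
    (hs0 : 0 ≤ s) (hs1 : s ≤ 1) (ht : 0 ≤ t)
    (hRR : Rkp ≤ Rc - 64 * (Real.exp (Rc * 5) * s * Real.exp ((4 * (D.F.L : ℝ) ^ (4 * D.m')) * t)))
    (hAmp : ∀ Z : (tsys 4 (D.cubesPerDir (k + 1))).Dom, Z.1 ⊆ X₀.1 → ∀ ℓ ∈ (torusLabels hk Z).filter fun ℓ =>
        ℓ.Z₀ = trefineDom D.F.L (D.cubesPerDir (k + 1)) Z ∧
          ℓ.P ⊆ bondsOfFineCubes hk (ℓ.Z₀.1 \ ℓ.fam.biUnion fun Y : (tsys 4 (D.F.L * D.cubesPerDir (k + 1))).Dom => Y.1) ∧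
          (ℓ.Z₀.1 \ ℓ.fam.biUnion fun Y : (tsys 4 (D.F.L * D.cubesPerDir (k + 1))).Dom => Y.1).card ≤ 2 * ℓ.P.card,
      (coreOf P Op 𝒵 dom Jc V (coreLettersOf D P Op 𝒵 dom Jc V mI A) (domEmb D.toTwoRuns (k + 1) Z) (InnerLabel.ofTorus hk ℓ)).lam.real univ *
          ((coreOf P Op 𝒵 dom Jc V (coreLettersOf D P Op 𝒵 dom Jc V mI A) (domEmb D.toTwoRuns (k + 1) Z) (InnerLabel.ofTorus hk ℓ)).wB *
              (gaussC (mI (domEmb D.toTwoRuns (k + 1) Z) (InnerLabel.ofTorus hk ℓ)) *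
                Real.sqrt (max 1 ((Fintype.card (mI (domEmb D.toTwoRuns (k + 1) Z) (InnerLabel.ofTorus hk ℓ))).factorial *
                  β₀ (domEmb D.toTwoRuns (k + 1) Z) (InnerLabel.ofTorus hk ℓ) ^
                    Fintype.card (mI (domEmb D.toTwoRuns (k + 1) Z) (InnerLabel.ofTorus hk ℓ)) +
                  d₀ (domEmb D.toTwoRuns (k + 1) Z) (InnerLabel.ofTorus hk ℓ)))) * Real.exp 0) *
          (Real.pi / ((γ (domEmb D.toTwoRuns (k + 1) Z) (InnerLabel.ofTorus hk ℓ) -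
              Fintype.card (mI (domEmb D.toTwoRuns (k + 1) Z) (InnerLabel.ofTorus hk ℓ)) *
                ϑ (domEmb D.toTwoRuns (k + 1) Z) (InnerLabel.ofTorus hk ℓ) * R' (k + 1)) / 2 / 2)) ^
            (Module.finrank ℝ (V (domEmb D.toTwoRuns (k + 1) Z) (InnerLabel.ofTorus hk ℓ)) / 2 : ℝ) *
        Real.exp ((coreOf P Op 𝒵 dom Jc V (coreLettersOf D P Op 𝒵 dom Jc V mI A) (domEmb D.toTwoRuns (k + 1) Z)
          (InnerLabel.ofTorus hk ℓ)).N₁ * (‖h₀‖ + μ₁ * ‖v‖)) ≤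
      A' * ((∏ Y ∈ ℓ.fam, (α₆ * Real.exp (-(δ * κ * torusTreeLen Y.1)) *
        Real.exp (-(Rc * (torusTreeLen Y.1 + 5))))) * (s ^ 2 * t) ^ ℓ.P.card))
    (h0 : 0 < μ₀) (h01 : μ₀ < μ₁) (hμ : ‖sμ‖ ≤ μ₀) :
    ‖locE (tgeometry 4 (D.cubesPerDir (k + 1))).ι (tgeometry 4 (D.cubesPerDir (k + 1))).cubes
          (fun Z => ∑ ℓ ∈ (torusLabels hk Z).filter fun ℓ =>
              ℓ.Z₀ = trefineDom D.F.L (D.cubesPerDir (k + 1)) Z ∧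
                ℓ.P ⊆ bondsOfFineCubes hk (ℓ.Z₀.1 \ ℓ.fam.biUnion fun Y : (tsys 4 (D.F.L * D.cubesPerDir (k + 1))).Dom => Y.1) ∧
                (ℓ.Z₀.1 \ ℓ.fam.biUnion fun Y : (tsys 4 (D.F.L * D.cubesPerDir (k + 1))).Dom => Y.1).card ≤ 2 * ℓ.P.card,
            actOfLetters P Op 𝒵 dom Jc V (coreLettersOf D P Op 𝒵 dom Jc V mI A) (domEmb D.toTwoRuns (k + 1) Z)
              (InnerLabel.ofTorus hk ℓ) o (h₀ + sμ • v))
            ((tgeometry 4 (D.cubesPerDir (k + 1))).cubes X₀) -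
        locE (tgeometry 4 (D.cubesPerDir (k + 1))).ι (tgeometry 4 (D.cubesPerDir (k + 1))).cubes
          (fun Z => ∑ ℓ ∈ (torusLabels hk Z).filter fun ℓ =>
              ℓ.Z₀ = trefineDom D.F.L (D.cubesPerDir (k + 1)) Z ∧
                ℓ.P ⊆ bondsOfFineCubes hk (ℓ.Z₀.1 \ ℓ.fam.biUnion fun Y : (tsys 4 (D.F.L * D.cubesPerDir (k + 1))).Dom => Y.1) ∧
                (ℓ.Z₀.1 \ ℓ.fam.biUnion fun Y : (tsys 4 (D.F.L * D.cubesPerDir (k + 1))).Dom => Y.1).card ≤ 2 * ℓ.P.card,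
            actOfLetters P Op 𝒵 dom Jc V (coreLettersOf D P Op 𝒵 dom Jc V mI A) (domEmb D.toTwoRuns (k + 1) Z)
              (InnerLabel.ofTorus hk ℓ) o h₀)
            ((tgeometry 4 (D.cubesPerDir (k + 1))).cubes X₀)‖ ≤
      Real.exp 1 * 9 * 64 * K₀ 64 8 ^ 2 * A' * Real.exp (-(r₁ * (tsys 4 (D.cubesPerDir (k + 1))).dj X₀)) * (μ₀ / (μ₁ - μ₀)) :=
  muPart_locE_le_of_actOfLetters_recordLabels_any hk P Op 𝒵 dom Jc V (coreLettersOf D P Op 𝒵 dom Jc V mI A)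
    (mq := fun k p _ => (γ p.1 p.2 - Fintype.card (mI p.1 p.2) * ϑ p.1 p.2 * R' k) / 2) (bq := fun _ _ _ => 0)
    (N₀ := fun _ p _ => gaussC (mI p.1 p.2) *
      Real.sqrt (max 1 ((Fintype.card (mI p.1 p.2)).factorial * β₀ p.1 p.2 ^ Fintype.card (mI p.1 p.2) + d₀ p.1 p.2)))
    hroom (margin_pos D mI hmq) (hN_coreLettersOf D P Op 𝒵 dom Jc V mI A hR' hbase hrdm hβ₀ hd₀ hrd hctr hbud)
    (hq_coreLettersOf D P Op 𝒵 dom Jc V mI A hbase hrdm hrd hctr) hg hO hH X₀ hA hr₁ hrate hsmall hα₆ hκ h229 hs0 hs1 ht hRR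
    hAmp h0 h01 hμ

end CoreLettersOf

end Summit.QuantumFields.BalabanUV.T4Continuum.NE1p.DressedSmallFieldRecordLabelsKillSlotLetters

end
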